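import Summits.AtomisticToContinuum.HydrodynamicLimit.Theorems.CollisionIsometryCLTDiffuseBackwardInfluenceStickSupersat
import HarnessLib

/-!
# `stub_stickLD`: the product-measure random-segment large deviation
(crux `DiffuseBackwardInfluence`, stmt-AtomisticToContinuum-12950, line `share-nondegeneracy-one-flight`;
registered stub `stub_stickLD`)

`FewIdle.StickLD σ θ` for `0 < σ < 1/2`, `θ > 0`: the container reduction `stickLD_of_supersat` (`…StickLD.lean`)
applied to the 7/3 crossing-energy law `stub_stickSupersat` (`…StickSupersat.lean`).
-/

namespace Summit.AtomisticToContinuum.HydrodynamicLimit.Theorems.DiffuseBackwardInfluenceShare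

noncomputable section

/-- **REGISTERED STUB `stub_stickLD`** — the static tube large deviation for independent sticks
(`FewIdle.StickLD σ θ`, `0 < σ < 1/2`, `θ > 0`): containers (`FewIdle.stickLD_of_supersat`) and the crossing-energy
law (`stub_stickSupersat`). [folklore] -/
theorem stub_stickLD : ∀ σ θ : ℝ, 0 < σ → σ < 1 / 2 → 0 < θ → FewIdle.StickLD σ θ :=
  fun σ θ h1 h2 h3 => FewIdle.stickLD_of_supersat σ θ h1 h3 (stub_stickSupersat σ θ h1 h2 h3)

end

end Summit.AtomisticToContinuum.HydrodynamicLimit.Theorems.DiffuseBackwardInfluenceShare
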